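import Summits.Ventures.PercRepro.C025ProfilePLDFiveLiftArith

/-!
# THE RANK-6 UNIFORM MATROID U_{6,m} FOR EVERY m ≥ 11 FROM THE CASE m = 11 AND FOUR PRESERVERS: THE ARITHMETIC (night-3 g33)

`proofs/NIGHT3-G33-RANKEIGHT.md` §6.  The profile of `U_{6,m}`, `m ≥ 11`, is `T₀₆ + m·T₁₆ + C(m,2)·T₂₆ + C(m,3)·T₃₆ + C(m,4)·T₄₆ +
C(m,5)·T₅₆ + c_m·δ₆₆` (`sum_choose_min_six`, `c_m = Σ_{6 ≤ i ≤ m−6} C(m,i)`), `m ↦ c_m` non-decreasing.  With `m = 11 + k`: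
`120·(U_{6,m} − U_{6,11}) = 120k·q₆ + 60k(15+k)·q₆′ + 20k(173 + 24k + k²)·q₆″ + 5k(1242 + 311k + 30k² + k³)·q₆‴ +
k(7334 + 2845k + 465k² + 35k³ + k⁴)·T₅₆ + 120(c_m − c₁₁)·δ₆₆` where `q₆ = T₁₆ + 3·T₂₆ + 6·T₃₆ + 9·T₄₆ + 11·T₅₆`,
`q₆′ = T₂₆ + 2·T₃₆ + 3·T₄₆ + 4·T₅₆`, `q₆″ = T₃₆ + 2·T₄₆ + 2·T₅₆`, `q₆‴ = T₄₆ + 2·T₅₆` (the preservers predicted by the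
joint-LP pattern `c_j = 6^{j−i₀}·i₀!/j!`, rounded up; `onehundredtwenty_mul_choose_five`, `choose_two_eleven`, …,
`choose_five_eleven`, `lift_alg_six`).  `T₅₆` (`PLDClosure.coloop` after `shift11` five times) and `δ₆₆` (`shift11` six
times) preserve PER-LAYER DOMINANCE (g29); the four `q`'s do at bounded rank (certificate tables); hence the lift
`lift_instance_six` for `11 ≤ m`.  No `def`, no `instance`, no notation.  Axioms: standard.
-/

namespace PercRepro

open Finset

namespace PLDSixLift

variable {ι : Type}

/-- The uniform profile of `U_{6,m}`, `m ≥ 11`: thirteen layers. -/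
theorem sum_choose_min_six (m : ℕ) (hm : 11 ≤ m) (g : ℕ → ℕ → ℕ) :
    ∑ i ∈ range (m + 1), m.choose i * g (min i 6) (min (m - i) 6) =
      g 0 6 + m * g 1 6 + m.choose 2 * g 2 6 + m.choose 3 * g 3 6 + m.choose 4 * g 4 6 + m.choose 5 * g 5 6 + (∑ i ∈ Ico 6 (m - 5), m.choose i) * g 6 6 + m.choose 5 * g 6 5 + m.choose 4 * g 6 4 + m.choose 3 * g 6 3 + m.choose 2 * g 6 2 + m * g 6 1 + g 6 0 := by
  obtain ⟨k, rfl⟩ : ∃ k, m = k + 11 := ⟨m - 11, by omega⟩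
  rw [sum_range_succ, sum_range_succ, sum_range_succ, sum_range_succ, sum_range_succ, sum_range_succ, sum_range_succ',
    sum_range_succ', sum_range_succ', sum_range_succ', sum_range_succ', sum_range_succ']
  have hmid : ∀ i ∈ range k, (k + 11).choose (i + 1 + 1 + 1 + 1 + 1 + 1) * g (min (i + 1 + 1 + 1 + 1 + 1 + 1) 6)
      (min (k + 11 - (i + 1 + 1 + 1 + 1 + 1 + 1)) 6) = (k + 11).choose (i + 1 + 1 + 1 + 1 + 1 + 1) * g 6 6 := by
    intro i hi
    rw [mem_range] at hi
    rw [show min (i + 1 + 1 + 1 + 1 + 1 + 1) 6 = 6 by omega,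
      show min (k + 11 - (i + 1 + 1 + 1 + 1 + 1 + 1)) 6 = 6 by omega]
  rw [sum_congr rfl hmid, ← sum_mul, show k + 11 - 5 = k + 6 by omega, sum_Ico_eq_sum_range,
    show k + 6 - 6 = k by omega]
  have hc : ∑ i ∈ range k, (k + 11).choose (6 + i) = ∑ i ∈ range k, (k + 11).choose (i + 1 + 1 + 1 + 1 + 1 + 1) :=
    sum_congr rfl fun i _ => by rw [show 6 + i = i + 1 + 1 + 1 + 1 + 1 + 1 by omega]
  have h1 : (k + 11).choose (0 + 1) = k + 11 := Nat.choose_one_right _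
  have h2 : (k + 11).choose (k + 10) = k + 11 := Nat.choose_succ_self_right (k + 10)
  have h3 : (k + 11).choose (k + 9) = (k + 11).choose 2 := by
    rw [← Nat.choose_symm (by omega : 2 ≤ k + 11), show k + 11 - 2 = k + 9 by omega]
  have h4 : (k + 11).choose (k + 8) = (k + 11).choose 3 := by
    rw [← Nat.choose_symm (by omega : 3 ≤ k + 11), show k + 11 - 3 = k + 8 by omega]
  have h5 : (k + 11).choose (k + 7) = (k + 11).choose 4 := by
    rw [← Nat.choose_symm (by omega : 4 ≤ k + 11), show k + 11 - 4 = k + 7 by omega]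
  have h6 : (k + 11).choose (k + 6) = (k + 11).choose 5 := by
    rw [← Nat.choose_symm (by omega : 5 ≤ k + 11), show k + 11 - 5 = k + 6 by omega]
  rw [hc, Nat.choose_zero_right, Nat.choose_self, h1, h2, h3, h4, h5, h6]
  simp only [show min (0 + 1) 6 = 1 by omega, show min (k + 10) 6 = 6 by omega, show min 0 6 = 0 by omega,
    show k + 11 - 0 = k + 11 by omega, show min (k + 11) 6 = 6 by omega, show k + 11 - (k + 10) = 1 by omega,
    show k + 11 - (k + 11) = 0 by omega, show min (0 + 1 + 1) 6 = 2 by omega, show min (k + 9) 6 = 6 by omega,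
    show k + 11 - (k + 9) = 2 by omega, show min (0 + 1 + 1 + 1) 6 = 3 by omega, show min (k + 8) 6 = 6 by omega,
    show k + 11 - (k + 8) = 3 by omega, show min (0 + 1 + 1 + 1 + 1) 6 = 4 by omega,
    show min (k + 7) 6 = 6 by omega, show k + 11 - (k + 7) = 4 by omega,
    show min (0 + 1 + 1 + 1 + 1 + 1) 6 = 5 by omega, show min (k + 6) 6 = 6 by omega,
    show k + 11 - (k + 6) = 5 by omega,
    show min (k + 11 - (0 + 1)) 6 = 6 by omega, show min (k + 11 - (0 + 1 + 1)) 6 = 6 by omega,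
    show min (k + 11 - (0 + 1 + 1 + 1)) 6 = 6 by omega, show min (k + 11 - (0 + 1 + 1 + 1 + 1)) 6 = 6 by omega, one_mul]
  ring

/-- `c_{m₀} ≤ c_m` for `m₀ ≤ m`. -/
theorem sum_choose_mid6_mono (m₀ m : ℕ) (hm : m₀ ≤ m) :
    ∑ i ∈ Ico 6 (m₀ - 5), m₀.choose i ≤ ∑ i ∈ Ico 6 (m - 5), m.choose i := by
  calc ∑ i ∈ Ico 6 (m₀ - 5), m₀.choose i ≤ ∑ i ∈ Ico 6 (m₀ - 5), m.choose i :=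
        sum_le_sum fun i _ => Nat.choose_le_choose i hm
    _ ≤ ∑ i ∈ Ico 6 (m - 5), m.choose i :=
        sum_le_sum_of_subset_of_nonneg (Ico_subset_Ico le_rfl (by omega)) fun _ _ _ => Nat.zero_le _

/-- `120·C(m,5) = m·(m−1)·(m−2)·(m−3)·(m−4)`. -/
theorem onehundredtwenty_mul_choose_five (m : ℕ) :
    120 * m.choose 5 = m * (m - 1) * (m - 2) * (m - 3) * (m - 4) := by
  rcases m with _ | n
  · rfl
  · have h := Nat.add_one_mul_choose_eq n 4
    have h4 := PLDFiveLift.twentyfour_mul_choose_four n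
    calc 120 * (n + 1).choose 5 = 24 * ((n + 1).choose (4 + 1) * (4 + 1)) := by ring
      _ = 24 * ((n + 1) * n.choose 4) := by rw [h]
      _ = (n + 1) * (24 * n.choose 4) := by ring
      _ = (n + 1) * (n * (n - 1) * (n - 2) * (n - 3)) := by rw [h4]
      _ = (n + 1) * (n + 1 - 1) * (n + 1 - 2) * (n + 1 - 3) * (n + 1 - 4) := by
        rcases n with _ | n
        · rfl
        · rcases n with _ | n
          · rfl
          · rcases n with _ | n
            · rfl
            · rw [show n + 1 + 1 + 1 + 1 - 1 = n + 3 by omega, show n + 1 + 1 + 1 + 1 - 2 = n + 2 by omega,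
                show n + 1 + 1 + 1 + 1 - 3 = n + 1 by omega, show n + 1 + 1 + 1 + 1 - 4 = n by omega,
                show n + 1 + 1 + 1 - 1 = n + 2 by omega, show n + 1 + 1 + 1 - 2 = n + 1 by omega,
                show n + 1 + 1 + 1 - 3 = n by omega]
              ring

/-- `120·C(11+k, 2) = 6600 + 1260k + 60k²`. -/
theorem choose_two_eleven (k : ℕ) : 120 * (11 + k).choose 2 = 6600 + 1260 * k + 60 * k * k := by
  have h := PLDSolidLift.two_mul_choose_two (11 + k)
  rw [show 11 + k - 1 = 10 + k by omega] at h
  nlinarith [h]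

/-- `120·C(11+k, 3) = 19800 + 5980k + 600k² + 20k³`. -/
theorem choose_three_eleven (k : ℕ) : 120 * (11 + k).choose 3 = 19800 + 5980 * k + 600 * k * k + 20 * k * k * k := by
  have h := PLDSolidLift.six_mul_choose_three (11 + k)
  rw [show 11 + k - 1 = 10 + k by omega, show 11 + k - 2 = 9 + k by omega] at h
  nlinarith [h]

/-- `120·C(11+k, 4) = 39600 + 16910k + 2695k² + 190k³ + 5k⁴`. -/
theorem choose_four_eleven (k : ℕ) : 120 * (11 + k).choose 4 = 39600 + 16910 * k + 2695 * k * k + 190 * k * k * k + 5 * k * k * k * k := by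
  have h := PLDFiveLift.twentyfour_mul_choose_four (11 + k)
  rw [show 11 + k - 1 = 10 + k by omega, show 11 + k - 2 = 9 + k by omega, show 11 + k - 3 = 8 + k by omega] at h
  nlinarith [h]

/-- `120·C(11+k, 5) = 55440 + 31594k + 7155k² + 805k³ + 45k⁴ + k⁵`. -/
theorem choose_five_eleven (k : ℕ) : 120 * (11 + k).choose 5 = 55440 + 31594 * k + 7155 * k * k + 805 * k * k * k + 45 * k * k * k * k + k * k * k * k * k := by
  have h := onehundredtwenty_mul_choose_five (11 + k)
  rw [show 11 + k - 1 = 10 + k by omega, show 11 + k - 2 = 9 + k by omega, show 11 + k - 3 = 8 + k by omega,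
    show 11 + k - 4 = 7 + k by omega] at h
  nlinarith [h]

/-- The linear algebra of the rank-6 lift from `m₀ = 11`, with the twenty-six layer sums and the coefficients abstracted
(`C₂ = C(11+k, 2)`, …, `C₅ = C(11+k, 5)`). -/
theorem lift_alg_six (a06 a16 a26 a36 a46 a56 a66 a65 a64 a63 a62 a61 a60
    b06 b16 b26 b36 b46 b56 b66 b65 b64 b63 b62 b61 b60 k k' C2 C3 C4 C5 c₀ : ℕ)
    (hC2 : 120 * C2 = 6600 + 1260 * k + 60 * k * k)
    (hC3 : 120 * C3 = 19800 + 5980 * k + 600 * k * k + 20 * k * k * k)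
    (hC4 : 120 * C4 = 39600 + 16910 * k + 2695 * k * k + 190 * k * k * k + 5 * k * k * k * k)
    (hC5 : 120 * C5 = 55440 + 31594 * k + 7155 * k * k + 805 * k * k * k + 45 * k * k * k * k + k * k * k * k * k)
    (h₀ : a06 + 11 * a16 + 55 * a26 + 165 * a36 + 330 * a46 + 462 * a56 + c₀ * a66 + 462 * a65 + 330 * a64 + 165 * a63 + 55 * a62 + 11 * a61 + a60 ≤
      b06 + 11 * b16 + 55 * b26 + 165 * b36 + 330 * b46 + 462 * b56 + c₀ * b66 + 462 * b65 + 330 * b64 + 165 * b63 + 55 * b62 + 11 * b61 + b60)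
    (hq : (a16 + a61) + 3 * (a26 + a62) + 6 * (a36 + a63) + 9 * (a46 + a64) + 11 * (a56 + a65) ≤ (b16 + b61) + 3 * (b26 + b62) + 6 * (b36 + b63) + 9 * (b46 + b64) + 11 * (b56 + b65))
    (hq' : (a26 + a62) + 2 * (a36 + a63) + 3 * (a46 + a64) + 4 * (a56 + a65) ≤ (b26 + b62) + 2 * (b36 + b63) + 3 * (b46 + b64) + 4 * (b56 + b65))
    (hq'' : (a36 + a63) + 2 * (a46 + a64) + 2 * (a56 + a65) ≤ (b36 + b63) + 2 * (b46 + b64) + 2 * (b56 + b65))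
    (hq''' : (a46 + a64) + 2 * (a56 + a65) ≤ (b46 + b64) + 2 * (b56 + b65))
    (hT : a56 + a65 ≤ b56 + b65) (hS : a66 ≤ b66) :
    a06 + (11 + k) * a16 + C2 * a26 + C3 * a36 + C4 * a46 + C5 * a56 + (c₀ + k') * a66 + C5 * a65 + C4 * a64 + C3 * a63 + C2 * a62 + (11 + k) * a61 + a60 ≤
      b06 + (11 + k) * b16 + C2 * b26 + C3 * b36 + C4 * b46 + C5 * b56 + (c₀ + k') * b66 + C5 * b65 + C4 * b64 + C3 * b63 + C2 * b62 + (11 + k) * b61 + b60 := by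
  have eC2a26 : 120 * C2 * a26 = (6600 + 1260 * k + 60 * k * k) * a26 := by rw [hC2]
  have eC2a62 : 120 * C2 * a62 = (6600 + 1260 * k + 60 * k * k) * a62 := by rw [hC2]
  have eC2b26 : 120 * C2 * b26 = (6600 + 1260 * k + 60 * k * k) * b26 := by rw [hC2]
  have eC2b62 : 120 * C2 * b62 = (6600 + 1260 * k + 60 * k * k) * b62 := by rw [hC2]
  have eC3a36 : 120 * C3 * a36 = (19800 + 5980 * k + 600 * k * k + 20 * k * k * k) * a36 := by rw [hC3]
  have eC3a63 : 120 * C3 * a63 = (19800 + 5980 * k + 600 * k * k + 20 * k * k * k) * a63 := by rw [hC3]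
  have eC3b36 : 120 * C3 * b36 = (19800 + 5980 * k + 600 * k * k + 20 * k * k * k) * b36 := by rw [hC3]
  have eC3b63 : 120 * C3 * b63 = (19800 + 5980 * k + 600 * k * k + 20 * k * k * k) * b63 := by rw [hC3]
  have eC4a46 : 120 * C4 * a46 = (39600 + 16910 * k + 2695 * k * k + 190 * k * k * k + 5 * k * k * k * k) * a46 := by rw [hC4]
  have eC4a64 : 120 * C4 * a64 = (39600 + 16910 * k + 2695 * k * k + 190 * k * k * k + 5 * k * k * k * k) * a64 := by rw [hC4]
  have eC4b46 : 120 * C4 * b46 = (39600 + 16910 * k + 2695 * k * k + 190 * k * k * k + 5 * k * k * k * k) * b46 := by rw [hC4]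
  have eC4b64 : 120 * C4 * b64 = (39600 + 16910 * k + 2695 * k * k + 190 * k * k * k + 5 * k * k * k * k) * b64 := by rw [hC4]
  have eC5a56 : 120 * C5 * a56 = (55440 + 31594 * k + 7155 * k * k + 805 * k * k * k + 45 * k * k * k * k + k * k * k * k * k) * a56 := by rw [hC5]
  have eC5a65 : 120 * C5 * a65 = (55440 + 31594 * k + 7155 * k * k + 805 * k * k * k + 45 * k * k * k * k + k * k * k * k * k) * a65 := by rw [hC5]
  have eC5b56 : 120 * C5 * b56 = (55440 + 31594 * k + 7155 * k * k + 805 * k * k * k + 45 * k * k * k * k + k * k * k * k * k) * b56 := by rw [hC5]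
  have eC5b65 : 120 * C5 * b65 = (55440 + 31594 * k + 7155 * k * k + 805 * k * k * k + 45 * k * k * k * k + k * k * k * k * k) * b65 := by rw [hC5]
  have hqk := Nat.mul_le_mul_left (120 * k) hq
  have hq'k := Nat.mul_le_mul_left (60 * k * (15 + k)) hq'
  have hq''k := Nat.mul_le_mul_left (20 * k * (173 + 24 * k + k * k)) hq''
  have hq'''k := Nat.mul_le_mul_left (5 * k * (1242 + 311 * k + 30 * k * k + k * k * k)) hq'''
  have hTk := Nat.mul_le_mul_left (k * (7334 + 2845 * k + 465 * k * k + 35 * k * k * k + k * k * k * k)) hT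
  have hSk := Nat.mul_le_mul_left (120 * k') hS
  linarith [eC2a26, eC2a62, eC2b26, eC2b62, eC3a36, eC3a63, eC3b36, eC3b63, eC4a46, eC4a64, eC4b46, eC4b64, eC5a56, eC5a65, eC5b56, eC5b65, hqk, hq'k, hq''k, hq'''k, hTk, hSk, h₀]

/-- THE LIFT IN `m` FOR `U_{6,m}` from `m₀ = 11`: for a family `(s, x, f)` with (PLD), `11 ≤ m`, an admissible `(lo, hi, δ, Θ)`,
the `q₆`-, `q₆′`-, `q₆″`-, `q₆‴`-instances and the `U_{6,11}`-instance give the `U_{6,m}`-instance. -/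
theorem lift_instance_six (s : Finset ι) (x f : ι → ℕ)
    (hPLD : ∀ lo hi δ Θ : ℕ, Θ ≤ lo + hi + δ → (lo = 0 ∨ lo + hi + δ ≤ Θ) →
      ∑ i ∈ s, (if lo ≤ x i ∧ x i ≤ hi ∧ Θ ≤ f i + x i then (f i).choose δ else 0) ≤
        ∑ i ∈ s, (if lo + δ ≤ f i ∧ f i ≤ hi + δ then (f i).choose δ else 0))
    (m : ℕ) (hm : 11 ≤ m) (lo hi δ Θ : ℕ) (hΘ : Θ ≤ lo + hi + δ) (hlo : lo = 0 ∨ lo + hi + δ ≤ Θ)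
    (hq : ∑ i ∈ s, (((if lo ≤ x i + 1 ∧ x i + 1 ≤ hi ∧ Θ ≤ (f i + 6) + (x i + 1) then (f i + 6).choose δ else 0) + (if lo ≤ x i + 6 ∧ x i + 6 ≤ hi ∧ Θ ≤ (f i + 1) + (x i + 6) then (f i + 1).choose δ else 0)) + 3 * ((if lo ≤ x i + 2 ∧ x i + 2 ≤ hi ∧ Θ ≤ (f i + 6) + (x i + 2) then (f i + 6).choose δ else 0) + (if lo ≤ x i + 6 ∧ x i + 6 ≤ hi ∧ Θ ≤ (f i + 2) + (x i + 6) then (f i + 2).choose δ else 0)) + 6 * ((if lo ≤ x i + 3 ∧ x i + 3 ≤ hi ∧ Θ ≤ (f i + 6) + (x i + 3) then (f i + 6).choose δ else 0) + (if lo ≤ x i + 6 ∧ x i + 6 ≤ hi ∧ Θ ≤ (f i + 3) + (x i + 6) then (f i + 3).choose δ else 0)) + 9 * ((if lo ≤ x i + 4 ∧ x i + 4 ≤ hi ∧ Θ ≤ (f i + 6) + (x i + 4) then (f i + 6).choose δ else 0) + (if lo ≤ x i + 6 ∧ x i + 6 ≤ hi ∧ Θ ≤ (f i + 4) + (x i +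 6) then (f i + 4).choose δ else 0)) + 11 * ((if lo ≤ x i + 5 ∧ x i + 5 ≤ hi ∧ Θ ≤ (f i + 6) + (x i + 5) then (f i + 6).choose δ else 0) + (if lo ≤ x i + 6 ∧ x i + 6 ≤ hi ∧ Θ ≤ (f i + 5) + (x i + 6) then (f i + 5).choose δ else 0))) ≤ ∑ i ∈ s, (((if lo + δ ≤ f i + 6 ∧ f i + 6 ≤ hi + δ then (f i + 6).choose δ else 0) + (if lo + δ ≤ f i + 1 ∧ f i + 1 ≤ hi + δ then (f i + 1).choose δ else 0)) + 3 * ((if lo + δ ≤ f i + 6 ∧ f i + 6 ≤ hi + δ then (f i + 6).choose δ else 0) + (if lo + δ ≤ f i + 2 ∧ f i + 2 ≤ hi + δ then (f i + 2).choose δ else 0)) + 6 * ((if lo + δ ≤ f i + 6 ∧ f i + 6 ≤ hi + δ then (f i + 6).choose δ else 0) + (if lo + δ ≤ f i + 3 ∧ f i + 3 ≤ hi + δ then (f i + 3).choose δ else 0)) + 9 * ((if lo + δ ≤ f i + 6 ∧ f i + 6 ≤ hi + δ then (f i + 6).choose δ else 0) + (if lo + δ ≤ f i + 4 ∧ f i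 + 4 ≤ hi + δ then (f i + 4).choose δ else 0)) + 11 * ((if lo + δ ≤ f i + 6 ∧ f i + 6 ≤ hi + δ then (f i + 6).choose δ else 0) + (if lo + δ ≤ f i + 5 ∧ f i + 5 ≤ hi + δ then (f i + 5).choose δ else 0))))
    (hq' : ∑ i ∈ s, (((if lo ≤ x i + 2 ∧ x i + 2 ≤ hi ∧ Θ ≤ (f i + 6) + (x i + 2) then (f i + 6).choose δ else 0) + (if lo ≤ x i + 6 ∧ x i + 6 ≤ hi ∧ Θ ≤ (f i + 2) + (x i + 6) then (f i + 2).choose δ else 0)) + 2 * ((if lo ≤ x i + 3 ∧ x i + 3 ≤ hi ∧ Θ ≤ (f i + 6) + (x i + 3) then (f i + 6).choose δ else 0) + (if lo ≤ x i + 6 ∧ x i + 6 ≤ hi ∧ Θ ≤ (f i + 3) + (x i + 6) then (f i + 3).choose δ else 0)) + 3 * ((if lo ≤ x i + 4 ∧ x i + 4 ≤ hi ∧ Θ ≤ (f i + 6) + (x i + 4) then (f i + 6).choose δ else 0) + (if lo ≤ x i + 6 ∧ x i + 6 ≤ hi ∧ Θ ≤ (f i + 4) + (x i + 6) then (f i +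 4).choose δ else 0)) + 4 * ((if lo ≤ x i + 5 ∧ x i + 5 ≤ hi ∧ Θ ≤ (f i + 6) + (x i + 5) then (f i + 6).choose δ else 0) + (if lo ≤ x i + 6 ∧ x i + 6 ≤ hi ∧ Θ ≤ (f i + 5) + (x i + 6) then (f i + 5).choose δ else 0))) ≤ ∑ i ∈ s, (((if lo + δ ≤ f i + 6 ∧ f i + 6 ≤ hi + δ then (f i + 6).choose δ else 0) + (if lo + δ ≤ f i + 2 ∧ f i + 2 ≤ hi + δ then (f i + 2).choose δ else 0)) + 2 * ((if lo + δ ≤ f i + 6 ∧ f i + 6 ≤ hi + δ then (f i + 6).choose δ else 0) + (if lo + δ ≤ f i + 3 ∧ f i + 3 ≤ hi + δ then (f i + 3).choose δ else 0)) + 3 * ((if lo + δ ≤ f i + 6 ∧ f i + 6 ≤ hi + δ then (f i + 6).choose δ else 0) + (if lo + δ ≤ f i + 4 ∧ f i + 4 ≤ hi + δ then (f i + 4).choose δ else 0)) + 4 * ((if lo + δ ≤ f i + 6 ∧ f i + 6 ≤ hi + δ then (f i + 6).choose δ else 0) + (if lo + δ ≤ f i + 5 ∧ f i + 5 ≤ hi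 + δ then (f i + 5).choose δ else 0))))
    (hq'' : ∑ i ∈ s, (((if lo ≤ x i + 3 ∧ x i + 3 ≤ hi ∧ Θ ≤ (f i + 6) + (x i + 3) then (f i + 6).choose δ else 0) + (if lo ≤ x i + 6 ∧ x i + 6 ≤ hi ∧ Θ ≤ (f i + 3) + (x i + 6) then (f i + 3).choose δ else 0)) + 2 * ((if lo ≤ x i + 4 ∧ x i + 4 ≤ hi ∧ Θ ≤ (f i + 6) + (x i + 4) then (f i + 6).choose δ else 0) + (if lo ≤ x i + 6 ∧ x i + 6 ≤ hi ∧ Θ ≤ (f i + 4) + (x i + 6) then (f i + 4).choose δ else 0)) + 2 * ((if lo ≤ x i + 5 ∧ x i + 5 ≤ hi ∧ Θ ≤ (f i + 6) + (x i + 5) then (f i + 6).choose δ else 0) + (if lo ≤ x i + 6 ∧ x i + 6 ≤ hi ∧ Θ ≤ (f i + 5) + (x i + 6) then (f i + 5).choose δ else 0))) ≤ ∑ i ∈ s, (((if lo + δ ≤ f i + 6 ∧ f i + 6 ≤ hi + δ then (f i + 6).choose δ else 0) + (if lo + δ ≤ f i + 3 ∧ f i + 3 ≤ hi + δ then (f i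 + 3).choose δ else 0)) + 2 * ((if lo + δ ≤ f i + 6 ∧ f i + 6 ≤ hi + δ then (f i + 6).choose δ else 0) + (if lo + δ ≤ f i + 4 ∧ f i + 4 ≤ hi + δ then (f i + 4).choose δ else 0)) + 2 * ((if lo + δ ≤ f i + 6 ∧ f i + 6 ≤ hi + δ then (f i + 6).choose δ else 0) + (if lo + δ ≤ f i + 5 ∧ f i + 5 ≤ hi + δ then (f i + 5).choose δ else 0))))
    (hq''' : ∑ i ∈ s, (((if lo ≤ x i + 4 ∧ x i + 4 ≤ hi ∧ Θ ≤ (f i + 6) + (x i + 4) then (f i + 6).choose δ else 0) + (if lo ≤ x i + 6 ∧ x i + 6 ≤ hi ∧ Θ ≤ (f i + 4) + (x i + 6) then (f i + 4).choose δ else 0)) + 2 * ((if lo ≤ x i + 5 ∧ x i + 5 ≤ hi ∧ Θ ≤ (f i + 6) + (x i + 5) then (f i + 6).choose δ else 0) + (if lo ≤ x i + 6 ∧ x i + 6 ≤ hi ∧ Θ ≤ (f i + 5) + (x i + 6) then (f i + 5).choose δ else 0))) ≤ ∑ i ∈ s, (((if lo + δ ≤ f i + 6 ∧ f i + 6 ≤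 hi + δ then (f i + 6).choose δ else 0) + (if lo + δ ≤ f i + 4 ∧ f i + 4 ≤ hi + δ then (f i + 4).choose δ else 0)) + 2 * ((if lo + δ ≤ f i + 6 ∧ f i + 6 ≤ hi + δ then (f i + 6).choose δ else 0) + (if lo + δ ≤ f i + 5 ∧ f i + 5 ≤ hi + δ then (f i + 5).choose δ else 0))))
    (h₀ : ∑ i ∈ s, ∑ j ∈ range (11 + 1), Nat.choose 11 j *
        (if lo ≤ x i + min j 6 ∧ x i + min j 6 ≤ hi ∧ Θ ≤ (f i + min (11 - j) 6) + (x i + min j 6) then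
          (f i + min (11 - j) 6).choose δ else 0) ≤
      ∑ i ∈ s, ∑ j ∈ range (11 + 1), Nat.choose 11 j *
        (if lo + δ ≤ f i + min (11 - j) 6 ∧ f i + min (11 - j) 6 ≤ hi + δ then (f i + min (11 - j) 6).choose δ else 0)) :
    ∑ i ∈ s, ∑ j ∈ range (m + 1), Nat.choose m j *
        (if lo ≤ x i + min j 6 ∧ x i + min j 6 ≤ hi ∧ Θ ≤ (f i + min (m - j) 6) + (x i + min j 6) then
          (f i + min (m - j) 6).choose δ else 0) ≤
      ∑ i ∈ s, ∑ j ∈ range (m + 1), Nat.choose m j *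
        (if lo + δ ≤ f i + min (m - j) 6 ∧ f i + min (m - j) 6 ≤ hi + δ then (f i + min (m - j) 6).choose δ else 0) := by
  -- the preservers `T₅₆` and `δ₆₆`
  have h11 : ∀ lo hi δ Θ : ℕ, Θ ≤ lo + hi + δ → (lo = 0 ∨ lo + hi + δ ≤ Θ) →
      ∑ i ∈ s, (if lo ≤ x i + 1 ∧ x i + 1 ≤ hi ∧ Θ ≤ (f i + 1) + (x i + 1) then (f i + 1).choose δ else 0) ≤
        ∑ i ∈ s, (if lo + δ ≤ f i + 1 ∧ f i + 1 ≤ hi + δ then (f i + 1).choose δ else 0) :=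
    fun lo hi δ Θ h1 h2 => PLDClosure.shift11 s x f hPLD lo hi δ Θ h1 h2
  have h22 : ∀ lo hi δ Θ : ℕ, Θ ≤ lo + hi + δ → (lo = 0 ∨ lo + hi + δ ≤ Θ) →
      ∑ i ∈ s, (if lo ≤ x i + 2 ∧ x i + 2 ≤ hi ∧ Θ ≤ (f i + 2) + (x i + 2) then (f i + 2).choose δ else 0) ≤
        ∑ i ∈ s, (if lo + δ ≤ f i + 2 ∧ f i + 2 ≤ hi + δ then (f i + 2).choose δ else 0) :=
    fun lo hi δ Θ h1 h2 => PLDClosure.shift11 s (fun i => x i + 1) (fun i => f i + 1) h11 lo hi δ Θ h1 h2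
  have h33 : ∀ lo hi δ Θ : ℕ, Θ ≤ lo + hi + δ → (lo = 0 ∨ lo + hi + δ ≤ Θ) →
      ∑ i ∈ s, (if lo ≤ x i + 3 ∧ x i + 3 ≤ hi ∧ Θ ≤ (f i + 3) + (x i + 3) then (f i + 3).choose δ else 0) ≤
        ∑ i ∈ s, (if lo + δ ≤ f i + 3 ∧ f i + 3 ≤ hi + δ then (f i + 3).choose δ else 0) :=
    fun lo hi δ Θ h1 h2 => PLDClosure.shift11 s (fun i => x i + 2) (fun i => f i + 2) h22 lo hi δ Θ h1 h2
  have h44 : ∀ lo hi δ Θ : ℕ, Θ ≤ lo + hi + δ → (lo = 0 ∨ lo + hi + δ ≤ Θ) →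
      ∑ i ∈ s, (if lo ≤ x i + 4 ∧ x i + 4 ≤ hi ∧ Θ ≤ (f i + 4) + (x i + 4) then (f i + 4).choose δ else 0) ≤
        ∑ i ∈ s, (if lo + δ ≤ f i + 4 ∧ f i + 4 ≤ hi + δ then (f i + 4).choose δ else 0) :=
    fun lo hi δ Θ h1 h2 => PLDClosure.shift11 s (fun i => x i + 3) (fun i => f i + 3) h33 lo hi δ Θ h1 h2
  have h55 : ∀ lo hi δ Θ : ℕ, Θ ≤ lo + hi + δ → (lo = 0 ∨ lo + hi + δ ≤ Θ) →
      ∑ i ∈ s, (if lo ≤ x i + 5 ∧ x i + 5 ≤ hi ∧ Θ ≤ (f i + 5) + (x i + 5) then (f i + 5).choose δ else 0) ≤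
        ∑ i ∈ s, (if lo + δ ≤ f i + 5 ∧ f i + 5 ≤ hi + δ then (f i + 5).choose δ else 0) :=
    fun lo hi δ Θ h1 h2 => PLDClosure.shift11 s (fun i => x i + 4) (fun i => f i + 4) h44 lo hi δ Θ h1 h2
  have hT : ∑ i ∈ s, (((if lo ≤ x i + 5 ∧ x i + 5 ≤ hi ∧ Θ ≤ (f i + 6) + (x i + 5) then (f i + 6).choose δ else 0) + (if lo ≤ x i + 6 ∧ x i + 6 ≤ hi ∧ Θ ≤ (f i + 5) + (x i + 6) then (f i + 5).choose δ else 0))) ≤ ∑ i ∈ s, (((if lo + δ ≤ f i + 6 ∧ f i + 6 ≤ hi + δ then (f i + 6).choose δ else 0) + (if lo + δ ≤ f i + 5 ∧ f i + 5 ≤ hi + δ then (f i + 5).choose δ else 0))) :=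
    PLDClosure.coloop s (fun i => x i + 5) (fun i => f i + 5) h55 lo hi δ Θ hΘ hlo
  have hS : ∑ i ∈ s, (if lo ≤ x i + 6 ∧ x i + 6 ≤ hi ∧ Θ ≤ (f i + 6) + (x i + 6) then (f i + 6).choose δ else 0) ≤ ∑ i ∈ s, (if lo + δ ≤ f i + 6 ∧ f i + 6 ≤ hi + δ then (f i + 6).choose δ else 0) :=
    PLDClosure.shift11 s (fun i => x i + 5) (fun i => f i + 5) h55 lo hi δ Θ hΘ hlo
  -- the thirteen layers, for `m` and for `11`
  have hLm : ∀ n : ℕ, 11 ≤ n → ∀ i ∈ s, ∑ j ∈ range (n + 1), Nat.choose n j *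
        (if lo ≤ x i + min j 6 ∧ x i + min j 6 ≤ hi ∧ Θ ≤ (f i + min (n - j) 6) + (x i + min j 6) then
          (f i + min (n - j) 6).choose δ else 0) =
      (if lo ≤ x i ∧ x i ≤ hi ∧ Θ ≤ (f i + 6) + (x i) then (f i + 6).choose δ else 0) + n * (if lo ≤ x i + 1 ∧ x i + 1 ≤ hi ∧ Θ ≤ (f i + 6) + (x i + 1) then (f i + 6).choose δ else 0) + n.choose 2 * (if lo ≤ x i + 2 ∧ x i + 2 ≤ hi ∧ Θ ≤ (f i + 6) + (x i + 2) then (f i + 6).choose δ else 0) + n.choose 3 * (if lo ≤ x i + 3 ∧ x i + 3 ≤ hi ∧ Θ ≤ (f i + 6) + (x i + 3) then (f i + 6).choose δ else 0) + n.choose 4 * (if lo ≤ x i + 4 ∧ x i + 4 ≤ hi ∧ Θ ≤ (f i + 6) + (x i + 4) then (f i + 6).choose δ else 0) + n.choose 5 * (if lo ≤ x i + 5 ∧ x i + 5 ≤ hi ∧ Θ ≤ (f i + 6) + (x i + 5) then (f i + 6).choose δ else 0) + (∑ i ∈ Ico 6 (n - 5), n.choose i) * (if lo ≤ x i + 6 ∧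 x i + 6 ≤ hi ∧ Θ ≤ (f i + 6) + (x i + 6) then (f i + 6).choose δ else 0) + n.choose 5 * (if lo ≤ x i + 6 ∧ x i + 6 ≤ hi ∧ Θ ≤ (f i + 5) + (x i + 6) then (f i + 5).choose δ else 0) + n.choose 4 * (if lo ≤ x i + 6 ∧ x i + 6 ≤ hi ∧ Θ ≤ (f i + 4) + (x i + 6) then (f i + 4).choose δ else 0) + n.choose 3 * (if lo ≤ x i + 6 ∧ x i + 6 ≤ hi ∧ Θ ≤ (f i + 3) + (x i + 6) then (f i + 3).choose δ else 0) + n.choose 2 * (if lo ≤ x i + 6 ∧ x i + 6 ≤ hi ∧ Θ ≤ (f i + 2) + (x i + 6) then (f i + 2).choose δ else 0) + n * (if lo ≤ x i + 6 ∧ x i + 6 ≤ hi ∧ Θ ≤ (f i + 1) + (x i + 6) then (f i + 1).choose δ else 0) + (if lo ≤ x i + 6 ∧ x i + 6 ≤ hi ∧ Θ ≤ (f i) + (x i + 6) then (f i).choose δ else 0) :=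
    fun n hn i _ => sum_choose_min_six n hn
      (fun a b => if lo ≤ x i + a ∧ x i + a ≤ hi ∧ Θ ≤ (f i + b) + (x i + a) then (f i + b).choose δ else 0)
  have hRm : ∀ n : ℕ, 11 ≤ n → ∀ i ∈ s, ∑ j ∈ range (n + 1), Nat.choose n j *
        (if lo + δ ≤ f i + min (n - j) 6 ∧ f i + min (n - j) 6 ≤ hi + δ then (f i + min (n - j) 6).choose δ else 0) =
      (if lo + δ ≤ f i + 6 ∧ f i + 6 ≤ hi + δ then (f i + 6).choose δ else 0) + n * (if lo + δ ≤ f i + 6 ∧ f i + 6 ≤ hi + δ then (f i + 6).choose δ else 0) + n.choose 2 * (if lo + δ ≤ f i + 6 ∧ f i + 6 ≤ hi + δ then (f i + 6).choose δ else 0) + n.choose 3 * (if lo + δ ≤ f i + 6 ∧ f i + 6 ≤ hi + δ then (f i + 6).choose δ else 0) + n.choose 4 * (if lo + δ ≤ f i + 6 ∧ f i + 6 ≤ hi + δ then (f i + 6).choose δ else 0) + n.choose 5 * (if lo + δ ≤ f i + 6 ∧ f i + 6 ≤ hi + δ then (f i + 6).choose δ else 0) + (∑ i ∈ Ico 6 (n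 - 5), n.choose i) * (if lo + δ ≤ f i + 6 ∧ f i + 6 ≤ hi + δ then (f i + 6).choose δ else 0) + n.choose 5 * (if lo + δ ≤ f i + 5 ∧ f i + 5 ≤ hi + δ then (f i + 5).choose δ else 0) + n.choose 4 * (if lo + δ ≤ f i + 4 ∧ f i + 4 ≤ hi + δ then (f i + 4).choose δ else 0) + n.choose 3 * (if lo + δ ≤ f i + 3 ∧ f i + 3 ≤ hi + δ then (f i + 3).choose δ else 0) + n.choose 2 * (if lo + δ ≤ f i + 2 ∧ f i + 2 ≤ hi + δ then (f i + 2).choose δ else 0) + n * (if lo + δ ≤ f i + 1 ∧ f i + 1 ≤ hi + δ then (f i + 1).choose δ else 0) + (if lo + δ ≤ f i ∧ f i ≤ hi + δ then (f i).choose δ else 0) :=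
    fun n hn i _ => sum_choose_min_six n hn
      (fun _ b => if lo + δ ≤ f i + b ∧ f i + b ≤ hi + δ then (f i + b).choose δ else 0)
  rw [sum_congr rfl (hLm m hm), sum_congr rfl (hRm m hm)]
  rw [sum_congr rfl (hLm 11 le_rfl), sum_congr rfl (hRm 11 le_rfl)] at h₀
  simp only [sum_add_distrib, ← mul_sum] at h₀ hq hq' hq'' hq''' ⊢
  rw [sum_add_distrib, sum_add_distrib] at hT
  -- the coefficients
  obtain ⟨k, hk⟩ := Nat.exists_eq_add_of_le hm
  obtain ⟨k', hk'⟩ := Nat.exists_eq_add_of_le (sum_choose_mid6_mono 11 m hm)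
  have hC2 : 120 * m.choose 2 = 6600 + 1260 * k + 60 * k * k := by rw [hk]; exact choose_two_eleven k
  have hC3 : 120 * m.choose 3 = 19800 + 5980 * k + 600 * k * k + 20 * k * k * k := by rw [hk]; exact choose_three_eleven k
  have hC4 : 120 * m.choose 4 = 39600 + 16910 * k + 2695 * k * k + 190 * k * k * k + 5 * k * k * k * k := by rw [hk]; exact choose_four_eleven k
  have hC5 : 120 * m.choose 5 = 55440 + 31594 * k + 7155 * k * k + 805 * k * k * k + 45 * k * k * k * k + k * k * k * k * k := by rw [hk]; exact choose_five_eleven k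
  have h11c2 : Nat.choose 11 2 = 55 := by decide
  have h11c3 : Nat.choose 11 3 = 165 := by decide
  have h11c4 : Nat.choose 11 4 = 330 := by decide
  have h11c5 : Nat.choose 11 5 = 462 := by decide
  rw [h11c2, h11c3, h11c4, h11c5] at h₀
  rw [hk']
  rw [hk] at hC2 hC3 hC4 hC5 ⊢
  exact lift_alg_six _ _ _ _ _ _ _ _ _ _ _ _ _ _ _ _ _ _ _ _ _ _ _ _ _ _ _ _ _ _ _ _ _ hC2 hC3 hC4 hC5 h₀ hq hq' hq'' hq''' hT hS

end PLDSixLift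

end PercRepro
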